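import Summits.AtomisticToContinuum.FouriersLaw.Theorems.OddSectorIrreversibilityOddCorrectorDecayVariationPathwise

/-!
# Pathwise bound on the current difference between the open and the closed pinned chain

Support file for item `stmt-AtomisticToContinuum-9139` (`OddSectorIrreversibility.OddCorrectorDecay`), negative
side, towards `OddSectorBathLocality`. Deterministic (path by path): for the open chain `z` driven by a continuous
momentum-noise path `η` (friction `γ ≥ 0`) and the closed chain `y`, both started at `x`, and a horizon `t₀`,
at every `t ∈ [0, t₀]`
`(J(z(t)) - J(y(t)))² ≤ (W(t) · (‖F(t)‖₁ + ∫₀ᵗ ‖F‖₁) · exp(∫₀ᵗ A))²`,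
where `W(t)` is a maximum over the sites of local polynomial weights of `z(t), y(t)`, `A(s) = (ω₂+4) + (3lam+48β) M(s)`
with `M(s)` the maximum over sites of the squared positions of `z(s), y(s)`, and `F_i(u) = η_i(u) - γ∫₀ᵘ w_i p_i(z)`
the boundary forcing (`ChainVariation.ell1_open_closed_le`, `sum_abs_dPotential_sub_le`, `abs_totalCurrent_sub_le`).
Every maximum is a `Finset.sup'` over the (nonempty, `N ≥ 1`) set of sites — the `N`-free constants are the point.
-/

noncomputable section

open MeasureTheory Set Filter Topology intervalIntegral Finset
open Literature.MathematicalPhysics.KineticTheory Literature.MathematicalPhysics.KineticTheory.HeatConduction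
open Literature.Analysis.ODE OscillatorChain

namespace Summit.AtomisticToContinuum.FouriersLaw.Theorems.ChainVariation

section PathBound

variable {ω₂ lam β γ : ℝ} (hω : 0 < ω₂) (hl : 0 ≤ lam) (hβ : 0 ≤ β) (hγ : 0 ≤ γ) {N : ℕ} (hN : 0 < N)
include hω hl hβ hγ hN

/-- **Pathwise product bound on the current difference** (see the module docstring). [folklore] -/
theorem sq_totalCurrent_sub_le_path (x : PhaseSpace N) {η : ℝ → Fin N → ℝ} (hη : Continuous η)
    {t₀ : ℝ} :
    ∀ t ∈ Icc (0:ℝ) t₀,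
      ((∑ i, (pinnedChain ω₂ lam β γ).bondCurrent N i ((pinnedChain ω₂ lam β γ).chainFlow N x η t)) -
          ∑ i, (pinnedChain ω₂ lam β γ).bondCurrent N i ((pinnedChain ω₂ lam β 0).chainFlow N x 0 t)) ^ 2 ≤
        (((Finset.univ.sup' (Finset.univ_nonempty_iff.2 (Fin.pos_iff_nonempty.1 hN))
            (fun i : Fin N => ∑ j : Fin N, if j.val = i.val + 1 then
              |deriv (pinnedChain ω₂ lam β γ).V (((pinnedChain ω₂ lam β γ).chainFlow N x η t).1 j -
                ((pinnedChain ω₂ lam β γ).chainFlow N x η t).1 i)| else 0)) +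
          2 * (Finset.univ.sup' (Finset.univ_nonempty_iff.2 (Fin.pos_iff_nonempty.1 hN))
            (fun i : Fin N => |((pinnedChain ω₂ lam β 0).chainFlow N x 0 t).2 i|)) *
            (1 + 12 * β * (Finset.univ.sup' (Finset.univ_nonempty_iff.2 (Fin.pos_iff_nonempty.1 hN))
              (fun i : Fin N => max (((pinnedChain ω₂ lam β γ).chainFlow N x η t).1 i ^ 2)
                (((pinnedChain ω₂ lam β 0).chainFlow N x 0 t).1 i ^ 2))))) *
        ((∑ i, |η t i - γ * ∫ v in (0:ℝ)..t, bathWeight N i * ((pinnedChain ω₂ lam β γ).chainFlow N x η v).2 i|) +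
          ∫ u in (0:ℝ)..t, ∑ i, |η u i - γ * ∫ v in (0:ℝ)..u,
            bathWeight N i * ((pinnedChain ω₂ lam β γ).chainFlow N x η v).2 i|) *
        Real.exp (∫ s in (0:ℝ)..t, ((ω₂ + 4) + (3 * lam + 48 * β) *
          (Finset.univ.sup' (Finset.univ_nonempty_iff.2 (Fin.pos_iff_nonempty.1 hN))
            (fun i : Fin N => max (((pinnedChain ω₂ lam β γ).chainFlow N x η s).1 i ^ 2)
              (((pinnedChain ω₂ lam β 0).chainFlow N x 0 s).1 i ^ 2)))))) ^ 2 := by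
  intro t ht
  have hne : (Finset.univ : Finset (Fin N)).Nonempty := Finset.univ_nonempty_iff.2 (Fin.pos_iff_nonempty.1 hN)
  set P := pinnedChain ω₂ lam β γ with hP
  set P₀ := pinnedChain ω₂ lam β 0 with hP₀
  set z : ℝ → PhaseSpace N := P.chainFlow N x η with hz
  set y : ℝ → PhaseSpace N := P₀.chainFlow N x 0 with hy
  have hzc : Continuous z := pinnedChain_continuous_chainFlow hω hl hβ hγ N x hη
  have h0c : Continuous (0 : ℝ → Fin N → ℝ) := continuous_const
  have hyc : Continuous y := pinnedChain_continuous_chainFlow hω hl hβ le_rfl N x (η := 0) h0c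
  -- the maximal squared position and the Grönwall coefficient
  set Mq : ℝ → ℝ := fun s => Finset.univ.sup' hne (fun i : Fin N => max ((z s).1 i ^ 2) ((y s).1 i ^ 2)) with hMq
  set A : ℝ → ℝ := fun s => (ω₂ + 4) + (3 * lam + 48 * β) * Mq s with hA
  have hMq0 : ∀ s, 0 ≤ Mq s := fun s => by
    obtain ⟨i, hi⟩ := hne
    exact le_trans (le_max_of_le_left (sq_nonneg ((z s).1 i))) (Finset.le_sup' (fun i : Fin N => max ((z s).1 i ^ 2) ((y s).1 i ^ 2)) (Finset.mem_univ i))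
  have hqz : ∀ s i, (z s).1 i ^ 2 ≤ Mq s := fun s i =>
    le_trans (le_max_left _ _) (Finset.le_sup' (fun i : Fin N => max ((z s).1 i ^ 2) ((y s).1 i ^ 2)) (Finset.mem_univ i))
  have hqy : ∀ s i, (y s).1 i ^ 2 ≤ Mq s := fun s i =>
    le_trans (le_max_right _ _) (Finset.le_sup' (fun i : Fin N => max ((z s).1 i ^ 2) ((y s).1 i ^ 2)) (Finset.mem_univ i))
  have hbond : ∀ (q : Fin N → ℝ) (s : ℝ), (∀ i, q i ^ 2 ≤ Mq s) →
      ∀ k l : Fin N, l.val = k.val + 1 → (q l - q k) ^ 2 ≤ 4 * Mq s := by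
    intro q s hq k l _
    nlinarith [hq k, hq l, sq_nonneg (q l + q k)]
  have hMqc : Continuous Mq := by
    refine Continuous.finset_sup'_apply hne fun i _ => ?_
    exact ((((continuous_apply i).comp (continuous_fst.comp hzc)).pow 2).max
      (((continuous_apply i).comp (continuous_fst.comp hyc)).pow 2))
  have hAc : Continuous A := continuous_const.add (continuous_const.mul hMqc)
  have hA1 : ∀ s, 1 ≤ A s := fun s => by
    have := hMq0 s
    simp only [hA]
    nlinarith [hω]
  -- the force hypothesis of the ℓ¹ comparison
  have hforce : ∀ u ∈ Icc (0:ℝ) t₀,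
      ∑ i, |P.dPotential N i (z u).1 - P.dPotential N i (y u).1| ≤ A u * ∑ i, |(z u).1 i - (y u).1 i| := by
    intro u _
    have h := sum_abs_dPotential_sub_le hω.le hl hβ γ (Mq := Mq u) (Mr := 4 * Mq u) (by linarith [hMq0 u])
      (z u).1 (y u).1 (hqz u) (hqy u) (hbond (z u).1 u (hqz u)) (hbond (y u).1 u (hqy u))
    refine h.trans (le_of_eq ?_)
    simp only [hA]; ring
  have hell := ell1_open_closed_le N hω hl hβ hγ x hη hAc hA1 hforce t ht
  -- the weights at time `t`
  set BV : ℝ := Finset.univ.sup' hne (fun i : Fin N => ∑ j : Fin N, if j.val = i.val + 1 then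
    |deriv P.V ((z t).1 j - (z t).1 i)| else 0) with hBV
  set Bp : ℝ := Finset.univ.sup' hne (fun i : Fin N => |(y t).2 i|) with hBp
  have hBV0 : 0 ≤ BV := by
    obtain ⟨i, hi⟩ := hne
    refine le_trans (Finset.sum_nonneg fun j _ => ?_) (Finset.le_sup' (fun i : Fin N => ∑ j : Fin N,
      if j.val = i.val + 1 then |deriv P.V ((z t).1 j - (z t).1 i)| else 0) (Finset.mem_univ i))
    split_ifs <;> positivity
  have hBp0 : 0 ≤ Bp := by
    obtain ⟨i, hi⟩ := hne
    exact le_trans (abs_nonneg _) (Finset.le_sup' (fun i : Fin N => |(y t).2 i|) (Finset.mem_univ i))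
  have hVb : ∀ i j : Fin N, j.val = i.val + 1 → |deriv P.V ((z t).1 j - (z t).1 i)| ≤ BV := by
    intro i j hij
    refine le_trans ?_ (Finset.le_sup' (fun i : Fin N => ∑ j : Fin N,
      if j.val = i.val + 1 then |deriv P.V ((z t).1 j - (z t).1 i)| else 0) (Finset.mem_univ i))
    have : |deriv P.V ((z t).1 j - (z t).1 i)| = (if j.val = i.val + 1 then |deriv P.V ((z t).1 j - (z t).1 i)| else 0) := by
      rw [if_pos hij]
    rw [this]
    exact Finset.single_le_sum (f := fun j : Fin N => if j.val = i.val + 1 then |deriv P.V ((z t).1 j - (z t).1 i)| else 0)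
      (fun j _ => by split_ifs <;> positivity) (Finset.mem_univ j)
  have hpb : ∀ i, |(y t).2 i| ≤ Bp := fun i => Finset.le_sup' (fun i : Fin N => |(y t).2 i|) (Finset.mem_univ i)
  have hcur := abs_totalCurrent_sub_le hβ ω₂ lam γ hBV0 hBp0 (by linarith [hMq0 t] : (0:ℝ) ≤ 4 * Mq t) (z t) (y t)
    hVb hpb (hbond (z t).1 t (hqz t)) (hbond (y t).1 t (hqy t))
  -- combine
  set W : ℝ := BV + 2 * Bp * (1 + 12 * β * Mq t) with hW
  set dq : ℝ := ∑ i, |(z t).1 i - (y t).1 i| with hdq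
  set dp : ℝ := ∑ i, |(z t).2 i - (y t).2 i| with hdp
  set Fn : ℝ := ∑ i, |η t i - γ * ∫ v in (0:ℝ)..t, bathWeight N i * (z v).2 i| with hFn
  set hI : ℝ := ∫ u in (0:ℝ)..t, ∑ i, |η u i - γ * ∫ v in (0:ℝ)..u, bathWeight N i * (z v).2 i| with hhI
  set E : ℝ := Real.exp (∫ s in (0:ℝ)..t, A s) with hE
  have hdq0 : 0 ≤ dq := Finset.sum_nonneg fun i _ => abs_nonneg _
  have hdp0 : 0 ≤ dp := Finset.sum_nonneg fun i _ => abs_nonneg _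
  have hFn0 : 0 ≤ Fn := Finset.sum_nonneg fun i _ => abs_nonneg _
  have hhI0 : 0 ≤ hI := intervalIntegral.integral_nonneg ht.1 fun u _ => Finset.sum_nonneg fun i _ => abs_nonneg _
  have hE1 : 1 ≤ E := by
    simp only [hE]
    exact Real.one_le_exp (intervalIntegral.integral_nonneg ht.1 fun s _ => (zero_le_one.trans (hA1 s)))
  have hKV : (1 + 3 * β * (4 * Mq t)) = 1 + 12 * β * Mq t := by ring
  have habs : |(∑ i, P.bondCurrent N i (z t)) - ∑ i, P.bondCurrent N i (y t)| ≤ W * (Fn + hI) * E := by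
    have h1 : |(∑ i, P.bondCurrent N i (z t)) - ∑ i, P.bondCurrent N i (y t)| ≤ W * (dq + dp) := by
      rw [hKV] at hcur
      have hW1 : BV ≤ W := by
        have : 0 ≤ 2 * Bp * (1 + 12 * β * Mq t) := by have := hMq0 t; positivity
        simp only [hW]; linarith
      have hc1 : BV * dp ≤ W * dp := mul_le_mul_of_nonneg_right hW1 hdp0
      have hc2 : 2 * Bp * (1 + 12 * β * Mq t) * dq ≤ W * dq :=
        mul_le_mul_of_nonneg_right (by simp only [hW]; linarith) hdq0
      calc _ ≤ BV * dp + 2 * Bp * (1 + 12 * β * Mq t) * dq := hcur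
        _ ≤ W * dp + W * dq := add_le_add hc1 hc2
        _ = W * (dq + dp) := by ring
    have hW0 : 0 ≤ W := by simp only [hW]; have := hMq0 t; positivity
    have h2 : dq + dp ≤ Fn + hI * E := hell
    have h3 : Fn + hI * E ≤ (Fn + hI) * E := by nlinarith
    calc _ ≤ W * (dq + dp) := h1
      _ ≤ W * ((Fn + hI) * E) := mul_le_mul_of_nonneg_left (h2.trans h3) hW0
      _ = W * (Fn + hI) * E := by ring
  have hsq := pow_le_pow_left₀ (abs_nonneg _) habs 2
  rw [sq_abs] at hsq
  exact hsq

end PathBound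

end Summit.AtomisticToContinuum.FouriersLaw.Theorems.ChainVariation

end
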